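import Mathlib
import Literature.NumberTheory.Transcendental.ZagierDilogarithmConjecture
import HarnessLib

/-!
# Monomial (signed permutation with per-index signs) symmetry under a Galois twist ⇒ self-similarity

Stub `stub_monomialSymmetric` of the line `kummer-clausen-linearisation` (reshape c2,
"Galois descent") for the crux `ZagierDilogarithmConjecture` (stmt-KontsevichZagierPeriods-10550,
route `HyperbolicBloch`).

Write `C := AddSubgroup.closure dilogRelators ⊆ ℤ[ℂ]` (`FreeAbelianGroup ℂ`) and
`ℚ̄ := algebraicClosure ℚ ℂ`. For a combination `β = Σ nᵢ[zᵢ]` put `β̄ := Σ nᵢ[z̄ᵢ]`,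
`ξ := β − β̄ = Σ nᵢ([zᵢ] − [z̄ᵢ])`, and for a `ℚ`-embedding `σ : ℚ̄ → ℂ` together with lifts
`wᵢ, w'ᵢ ∈ ℚ̄` of `zᵢ, z̄ᵢ` put `S₁ := Σ nᵢ[σwᵢ]`, `S₂ := Σ nᵢ[σw'ᵢ]`, `σ_*ξ := S₁ − S₂`. The
combination is *self-similar at `σ`* if there are integers `a ≠ 0`, `b` with `a•σ_*ξ − b•ξ ∈ C`.

**The monomial case** (`stub_monomialSymmetric`): a family `u = (uᵢ)ᵢ` of complex numbers is
*monomial over `β`* if there are `e ∈ ℤ` and a permutation `π` of the indices such that, for every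
`i`, either `uᵢ` is real and `e·n_{πi} = 0`, or `uᵢ = z_{πi}` and `nᵢ = e·n_{πi}`, or `uᵢ = z̄_{πi}`
and `nᵢ = −e·n_{πi}` (so `σ` acts on the formal combination as `e` times a signed permutation
matrix, the signs varying with the index). If both families `(σwᵢ)ᵢ` and `(σw'ᵢ)ᵢ` are monomial
over `β`, the combination is self-similar at `σ`, with `a = 2`. This refines the constant-sign case
`stub_signedPermutation` of the same line.

Proof: the `zᵢ = wᵢ` are algebraic. KEY LEMMA (`monomial_sum_sub_zsmul_sum_mem_closure`): for a
monomial family `u` with data `(e, π)`, `Σ nᵢ[uᵢ] − e•β ∈ C`. Indeed, reindexing `β` along `π`,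
`Σ nᵢ[uᵢ] − e•β = Σᵢ (nᵢ[uᵢ] − (e·n_{πi})[z_{πi}])`, and each summand lies in `C`: in the real case
it is `nᵢ[uᵢ]` (relator `[w]`, `w` real); in the `+` case it is `0`; in the `−` case it is
`nᵢ([z̄_{πi}] + [z_{πi}])` (relator `[w] + [w̄]`, `w` algebraic). With `e₁, e₂` for `S₁, S₂` and
`β + β̄ = Σ nᵢ([zᵢ] + [z̄ᵢ]) ∈ C`, the identity
`2•(S₁ − S₂) − (e₁ − e₂)•(β − β̄) = 2•(S₁ − e₁•β) − 2•(S₂ − e₂•β) + (e₁ − e₂)•(β + β̄)`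
(`monomial_two_zsmul_sub_sub_zsmul_sub_mem`) exhibits `2•σ_*ξ − (e₁ − e₂)•ξ` as a member of `C`.

Sources: Neumann 1998 §2 (the relator group: five-term elements, `[w] + [w̄]`, real `[w]`);
Zagier 2007 Ch. I §§3–4. The computation itself is elementary [folklore].
Not here: which field-theoretic data produce the monomial hypothesis (cyclotomic points with
signs, biquadratic fields) and the propagation of `Σ nᵢ D(zᵢ) = 0` from self-similarity
(`stub_selfSimilar`) — separate stubs of the line.
-/

noncomputable section

open scoped BigOperators ComplexConjugate
open Literature.NumberTheory.Transcendental

namespace Summit.KontsevichZagierPeriods.HyperbolicBloch.ZagierDilogarithmGaloisDescent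

/-- The `ℤ`-linear bookkeeping of the monomial case: in an additive commutative group with a
subgroup `C`, if `S₁ − e₁•β ∈ C`, `S₂ − e₂•β ∈ C` and `β + β' ∈ C`, then
`2•(S₁ − S₂) − (e₁ − e₂)•(β − β') ∈ C`, because
`2•(S₁ − S₂) − (e₁ − e₂)•(β − β') = 2•(S₁ − e₁•β) − 2•(S₂ − e₂•β) + (e₁ − e₂)•(β + β')`.
[folklore] -/
theorem monomial_two_zsmul_sub_sub_zsmul_sub_mem {G : Type*} [AddCommGroup G] (C : AddSubgroup G)
    {S₁ S₂ β β' : G} {e₁ e₂ : ℤ} (h₁ : S₁ - e₁ • β ∈ C) (h₂ : S₂ - e₂ • β ∈ C)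
    (hP : β + β' ∈ C) :
    (2 : ℤ) • (S₁ - S₂) - (e₁ - e₂) • (β - β') ∈ C := by
  have hid : (2 : ℤ) • (S₁ - S₂) - (e₁ - e₂) • (β - β') =
      (2 : ℤ) • (S₁ - e₁ • β) - (2 : ℤ) • (S₂ - e₂ • β) + (e₁ - e₂) • (β + β') := by
    module
  rw [hid]
  exact add_mem (sub_mem (C.zsmul_mem h₁ _) (C.zsmul_mem h₂ _)) (C.zsmul_mem hP _)

/-- **Key lemma: a monomial family is congruent to `e•β` modulo the relators.** Let `zᵢ ∈ ℂ` be
algebraic, `nᵢ ∈ ℤ`, and let `u = (uᵢ)ᵢ` be monomial over `β = Σ nᵢ[zᵢ]` with data `(e, π)`: for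
every `i`, either `uᵢ` is real and `e·n_{πi} = 0`, or `uᵢ = z_{πi}` and `nᵢ = e·n_{πi}`, or
`uᵢ = z̄_{πi}` and `nᵢ = −e·n_{πi}`. Then `Σ nᵢ[uᵢ] − e • Σ nᵢ[zᵢ] ∈ ⟨dilogRelators⟩`: after
reindexing `β` along `π` the difference is `Σᵢ (nᵢ[uᵢ] − (e·n_{πi})[z_{πi}])`, whose summands are
a real relator `nᵢ[uᵢ]`, or `0`, or `nᵢ([z̄_{πi}] + [z_{πi}])` respectively. [folklore] -/
theorem monomial_sum_sub_zsmul_sum_mem_closure {k : ℕ} (z u : Fin k → ℂ) (n : Fin k → ℤ)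
    (hz : ∀ i, IsAlgebraic ℚ (z i)) (e : ℤ) (π : Equiv.Perm (Fin k))
    (hu : ∀ i, ((u i).im = 0 ∧ e * n (π i) = 0) ∨ (u i = z (π i) ∧ n i = e * n (π i)) ∨
      (u i = conj (z (π i)) ∧ n i = -(e * n (π i)))) :
    (∑ i, n i • FreeAbelianGroup.of (u i)) - e • (∑ i, n i • FreeAbelianGroup.of (z i)) ∈
      AddSubgroup.closure dilogRelators := by
  -- reindex `β` along `π` and distribute `e`
  have hβ : e • (∑ i, n i • FreeAbelianGroup.of (z i)) =
      ∑ i, (e * n (π i)) • FreeAbelianGroup.of (z (π i)) := by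
    rw [← Equiv.sum_comp π (fun j => n j • FreeAbelianGroup.of (z j)), Finset.smul_sum]
    exact Finset.sum_congr rfl fun i _ => smul_smul e (n (π i)) _
  rw [hβ, ← Finset.sum_sub_distrib]
  refine AddSubgroup.sum_mem _ fun i _ => ?_
  rcases hu i with ⟨hreal, h0⟩ | ⟨hui, hni⟩ | ⟨hui, hni⟩
  · -- `uᵢ` real, `e·n_{πi} = 0`: the summand is the real relator `nᵢ[uᵢ]`
    rw [h0, zero_smul, sub_zero]
    exact AddSubgroup.zsmul_mem _ (AddSubgroup.subset_closure (of_real_mem_dilogRelators hreal)) _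
  · -- `uᵢ = z_{πi}`, `nᵢ = e·n_{πi}`: the summand vanishes
    rw [hui, ← hni, sub_self]
    exact zero_mem _
  · -- `uᵢ = z̄_{πi}`, `nᵢ = −e·n_{πi}`: the summand is `nᵢ([z̄_{πi}] + [z_{πi}])`
    have h' : e * n (π i) = -n i := by rw [hni, neg_neg]
    rw [hui, h', neg_smul, sub_neg_eq_add, ← smul_add, add_comm]
    exact AddSubgroup.zsmul_mem _
      (AddSubgroup.subset_closure (of_add_of_conj_mem_dilogRelators (hz (π i)))) _

/-- **Monomial symmetry under a Galois twist ⇒ self-similarity.** Let `zᵢ ∈ ℂ`, `nᵢ ∈ ℤ`,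
`σ : ℚ̄ → ℂ` a `ℚ`-embedding (`ℚ̄ = algebraicClosure ℚ ℂ`) and `wᵢ, w'ᵢ ∈ ℚ̄` lifts of `zᵢ, z̄ᵢ`.
Suppose (for all such data) that each of the families `u = (σwᵢ)ᵢ`, `(σw'ᵢ)ᵢ` is MONOMIAL over
`β = Σ nᵢ[zᵢ]`: there are `e ∈ ℤ` and a permutation `π` with, for every `i`, either `uᵢ` real and
`e·n_{πi} = 0`, or `uᵢ = z_{πi}` and `nᵢ = e·n_{πi}`, or `uᵢ = z̄_{πi}` and `nᵢ = −e·n_{πi}`.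
Then there are `a ≠ 0`, `b ∈ ℤ` (namely `a = 2`, `b = e₁ − e₂`) with
`a•σ_*ξ − b•ξ ∈ ⟨dilogRelators⟩`, where `ξ = Σ nᵢ([zᵢ] − [z̄ᵢ])` and
`σ_*ξ = Σ nᵢ([σwᵢ] − [σw'ᵢ])`: with `S₁ = Σ nᵢ[σwᵢ]`, `S₂ = Σ nᵢ[σw'ᵢ]`, `β̄ = Σ nᵢ[z̄ᵢ]` one has
`Sⱼ − eⱼ•β ∈ C` (key lemma) and `β + β̄ = Σ nᵢ([zᵢ] + [z̄ᵢ]) ∈ C` (relators `[w] + [w̄]`), and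
`2•(S₁ − S₂) − (e₁ − e₂)•(β − β̄) = 2•(S₁ − e₁•β) − 2•(S₂ − e₂•β) + (e₁ − e₂)•(β + β̄)`.
Refines `stub_signedPermutation` (constant sign); needed because `ℍ⁺`-normalised Galois orbits
carry per-index signs (e.g. `[ζ₇] + [ζ₇²] − [ζ₇³]` under `ζ ↦ ζ²`). [folklore] -/
theorem stub_monomialSymmetric :
    ∀ (k : ℕ) (z : Fin k → ℂ) (n : Fin k → ℤ),
      (∀ (σ : ↥(algebraicClosure ℚ ℂ) →ₐ[ℚ] ℂ) (w w' : Fin k → ↥(algebraicClosure ℚ ℂ)),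
          (∀ i, (w i : ℂ) = z i) → (∀ i, (w' i : ℂ) = conj (z i)) →
          (∃ (e : ℤ) (π : Equiv.Perm (Fin k)), ∀ i,
              ((σ (w i)).im = 0 ∧ e * n (π i) = 0) ∨ (σ (w i) = z (π i) ∧ n i = e * n (π i)) ∨
                (σ (w i) = conj (z (π i)) ∧ n i = -(e * n (π i)))) ∧
          (∃ (e : ℤ) (π : Equiv.Perm (Fin k)), ∀ i,
              ((σ (w' i)).im = 0 ∧ e * n (π i) = 0) ∨ (σ (w' i) = z (π i) ∧ n i = e * n (π i)) ∨
                (σ (w' i) = conj (z (π i)) ∧ n i = -(e * n (π i))))) →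
        ∀ (σ : ↥(algebraicClosure ℚ ℂ) →ₐ[ℚ] ℂ) (w w' : Fin k → ↥(algebraicClosure ℚ ℂ)),
          (∀ i, (w i : ℂ) = z i) → (∀ i, (w' i : ℂ) = conj (z i)) →
          ∃ a b : ℤ, a ≠ 0 ∧
            a • (∑ i, n i • (FreeAbelianGroup.of (σ (w i)) - FreeAbelianGroup.of (σ (w' i)))) -
              b • (∑ i, n i • (FreeAbelianGroup.of (z i) - FreeAbelianGroup.of (conj (z i)))) ∈
                AddSubgroup.closure dilogRelators := by
  intro k z n hmon σ w w' hw hw'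
  obtain ⟨⟨e₁, π₁, h₁⟩, ⟨e₂, π₂, h₂⟩⟩ := hmon σ w w' hw hw'
  -- the `zᵢ = wᵢ ∈ ℚ̄` are algebraic
  have hz : ∀ i, IsAlgebraic ℚ (z i) := fun i => hw i ▸ mem_algebraicClosure_iff.1 (w i).2
  -- `Sⱼ − eⱼ•β ∈ C` for the two families (key lemma)
  have he₁ := monomial_sum_sub_zsmul_sum_mem_closure z (fun i => σ (w i)) n hz e₁ π₁ h₁
  have he₂ := monomial_sum_sub_zsmul_sum_mem_closure z (fun i => σ (w' i)) n hz e₂ π₂ h₂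
  -- `β + β̄ = Σ nᵢ([zᵢ] + [z̄ᵢ]) ∈ C`
  have hP : (∑ i, n i • FreeAbelianGroup.of (z i)) + (∑ i, n i • FreeAbelianGroup.of (conj (z i))) ∈
      AddSubgroup.closure dilogRelators := by
    rw [← Finset.sum_add_distrib]
    refine AddSubgroup.sum_mem _ fun i _ => ?_
    rw [← zsmul_add]
    exact AddSubgroup.zsmul_mem _
      (AddSubgroup.subset_closure (of_add_of_conj_mem_dilogRelators (hz i))) _
  refine ⟨2, e₁ - e₂, two_ne_zero, ?_⟩
  have hξσ : ∑ i, n i • (FreeAbelianGroup.of (σ (w i)) - FreeAbelianGroup.of (σ (w' i))) =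
      (∑ i, n i • FreeAbelianGroup.of (σ (w i))) - ∑ i, n i • FreeAbelianGroup.of (σ (w' i)) := by
    simp only [zsmul_sub, Finset.sum_sub_distrib]
  have hξ : ∑ i, n i • (FreeAbelianGroup.of (z i) - FreeAbelianGroup.of (conj (z i))) =
      (∑ i, n i • FreeAbelianGroup.of (z i)) - ∑ i, n i • FreeAbelianGroup.of (conj (z i)) := by
    simp only [zsmul_sub, Finset.sum_sub_distrib]
  rw [hξσ, hξ]
  exact monomial_two_zsmul_sub_sub_zsmul_sub_mem _ he₁ he₂ hP

end Summit.KontsevichZagierPeriods.HyperbolicBloch.ZagierDilogarithmGaloisDescent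

end
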